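import Summits.QuantumFields.YangMills.Theses.FradkinShenkerFlow
import Summits.QuantumFields.YangMills.Theses.ConvexGribovBody
import HarnessLib

/-!
# `ClusteringToYangMills` (stmt-QuantumFields-9443) is dominated by `ContinuumLegGivenGap` (stmt-QuantumFields-8782)

Support file for the crux item stmt-QuantumFields-9443 of route `FradkinShenkerFlow` (sub-problem `YangMills`),
recorded by the line lead of `spectral-requantisation-dock` (all three crux-triage reports r1-1/2/3 and the
standing disprover's `Disproof.lean` §4 asked that this dominance be in the tree, importable):

the shared existence leg `Summit.QuantumFields.YangMills.Theses.ConvexGribovBody.ContinuumLegGivenGap`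
(stmt-QuantumFields-8782, routes `ConvexGribovBody` / `SmallCircleAnchor`: "IF for every faithful `r` the torus
Wilson measures cluster exponentially in Euclidean time at every `β ≥ β₀(r)`, uniformly on all tori of half-side
`S ≥ S₁(β)`, THEN the Clay witness exists") implies the crux
`Summit.QuantumFields.YangMills.Theses.FradkinShenkerFlow.ClusteringToYangMills` ("IF … uniformly on ALL tori …
THEN `YangMills`"): the crux's hypothesis is the special case `S₁ ≡ 0` of the leg's.  Whoever proves 8782 closes
9443 by `ClusteringToYangMills_of_continuumLegGivenGap`.

Pure logic over the two route declarations; no definitions, no facts.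
-/

namespace Summit.QuantumFields.YangMills.Theorems.ClusteringToYangMills

open Summit.QuantumFields.YangMills.Theses

/-- **Dominance `8782 ⇒ 9443`.** `ContinuumLegGivenGap` (stmt-QuantumFields-8782) implies
`ClusteringToYangMills` (stmt-QuantumFields-9443): feed the leg, for the compact simple `G` at hand (with its
Borel structure) and every faithful `r`, the crux's clustering hypothesis with volume threshold `S₁ := 0`
(clustering on all odd symmetric tori is clustering on all tori of half-side `≥ 0`). [folklore] -/
theorem ClusteringToYangMills_of_continuumLegGivenGap (h : ConvexGribovBody.ContinuumLegGivenGap) :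
    FradkinShenkerFlow.ClusteringToYangMills := by
  intro hEC G _ _ _ _ hG
  letI : MeasurableSpace G := borel G
  haveI : BorelSpace G := ⟨rfl⟩
  refine h G hG (fun r => ?_)
  obtain ⟨β₀, hβ₀⟩ := hEC G hG r
  refine ⟨β₀, fun β hβ => ?_⟩
  obtain ⟨m, hm, hAB⟩ := hβ₀ β hβ
  exact ⟨m, hm, 0, fun A B => (hAB A B).imp fun C hC S n _ hn => hC S n hn⟩

end Summit.QuantumFields.YangMills.Theorems.ClusteringToYangMills
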